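import Summits.Parity.GeneralizedHardyLittlewood.Theorems.BeyondDiagonalBeatsQuarter.OffDiagHeartResidual
import Summits.Parity.GeneralizedHardyLittlewood.Theorems.BeyondDiagonalBeatsQuarter.OffDiagHeartCoreTruncation
import HarnessLib

/-!
# Route `PrimeLevelFamEdge`, crux K_B (stmt-Parity-20343), line `diagonal_kernel_split` rev 4, plan Ω,
# **L9″ (glue) — the heart from an EVENTUAL piece decomposition of the dual core: funded pieces + one residual**

`OffDiagHeartResidual.offDiagBelowSlack_io_of_residual` (p649229) wants an identity `Σ_{q∈goodPrimes} offDiagCore = F + Rsd`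
for ALL `N`, a funded `F` (`≤ ε·Σms` eventually, every `ε > 0`) and a residual `Rsd` with the clean-scale block bound.
The CoreSplit identity (`OffDiagCoreSplit`: `Σ offDiagCore = coreP + coreS_R + coreL_R + coreX`, prover-6) holds only for
blocks of primes `≥ 40`, i.e. EVENTUALLY in `N`, and the principal piece `coreP` splits further into a funded part and the
unfunded short-moduli transition row `(U)` (TRANSITION-SIZING §8–§9). This file provides the glue in exactly that shape
(«funded» below always means `∀ Δ′ ∈ (1,2) ∀ ε > 0 ∃ N₀ ∀ N ≥ N₀: piece ≤ ε·Σ_{q∈goodPrimes Δ′ N} ms`, written out):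

* **`offDiagBelowSlack_io_of_pieces`** — for ANY height `Hf` with (T), pieces `P S L Xc` with the EVENTUAL identity
  `Σ_{q∈goodPrimes Δ′ N} offDiagCore Hf Δ′ q = P + S + L + Xc` (all `N ≥ N₀(Δ′)`), a further split `P = FP + U`, funded
  `FP`, `L`, `Xc`, and the clean-scale residual bound for `S + U`: `stub_offDiagBelowSlack_io` VERBATIM
  (take `F := total − (S + U)`, so the identity of p649229 holds by definition and `F` is funded because it agrees with
  `FP + L + Xc` eventually);
* **`offDiagBelowSlack_io_of_pieces_coreHeight`** — the same with (T) DISCHARGED at the height `coreHeight ε₀`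
  (`OffDiagHeartCoreTruncation.abs_offDiagNearHead_sub_offDiagCore_le_eventually`, p649489), any `ε₀ ∈ (0,1]`.

The instantiation `P S L Xc := coreP, coreS_R, coreL_R, coreX (goodPrimes Δ′ N) (coreHeight ε₀) Δ′` is one `fun` per piece
once `OffDiagCoreSplit` is in the tree; the funded hypotheses are L7d (coreL), E14/A8P (the funded part of coreP) and the
doubly-non-unit stratum (coreX); the residual `(S) + (U)` is the displayed research-grade hypothesis of the line.
Helper; closes nothing; no definitions; standard axioms. «The programme SEARCHES and TYPES; no claim about Landau–Siegel
zeros, Theorems 1–2 of arXiv:2211.02515 or a repaired Margin232 until a kernel theorem says so.»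
-/

noncomputable section

open Finset Polynomial
open scoped Real

namespace Summit.Parity.GeneralizedHardyLittlewood.Theorems.BeyondDiagonalBeatsQuarter.OffDiag

open Literature.NumberTheory.LFunctions Literature.NumberTheory.LFunctions.KMV2000
open PeterssonSplit (offDiag)

/-- **Three funded pieces and an eventual identity make a funded piece**: if `F = FP + L + Xc` for all large `N`
(each `Δ′ ∈ (1,2)`) and `FP`, `L`, `Xc` are each eventually `≤ ε·Σms` for every `ε > 0`, so is `F`. [folklore] -/
theorem funded_of_eventually_eq_add_add (F FP L Xc : ℝ → ℕ → ℝ)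
    (hEq : ∀ Δ' : ℝ, 1 < Δ' → Δ' < 2 → ∃ N₀ : ℕ, ∀ N : ℕ, N₀ ≤ N → F Δ' N = FP Δ' N + L Δ' N + Xc Δ' N)
    (hFP : ∀ Δ' : ℝ, 1 < Δ' → Δ' < 2 → ∀ ε : ℝ, 0 < ε → ∃ N₀ : ℕ, ∀ N : ℕ, N₀ ≤ N →
      FP Δ' N ≤ ε * ∑ q ∈ goodPrimes Δ' N, mainScaleReal Δ' q)
    (hL : ∀ Δ' : ℝ, 1 < Δ' → Δ' < 2 → ∀ ε : ℝ, 0 < ε → ∃ N₀ : ℕ, ∀ N : ℕ, N₀ ≤ N →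
      L Δ' N ≤ ε * ∑ q ∈ goodPrimes Δ' N, mainScaleReal Δ' q)
    (hX : ∀ Δ' : ℝ, 1 < Δ' → Δ' < 2 → ∀ ε : ℝ, 0 < ε → ∃ N₀ : ℕ, ∀ N : ℕ, N₀ ≤ N →
      Xc Δ' N ≤ ε * ∑ q ∈ goodPrimes Δ' N, mainScaleReal Δ' q) :
    ∀ Δ' : ℝ, 1 < Δ' → Δ' < 2 → ∀ ε : ℝ, 0 < ε → ∃ N₀ : ℕ, ∀ N : ℕ, N₀ ≤ N →
      F Δ' N ≤ ε * ∑ q ∈ goodPrimes Δ' N, mainScaleReal Δ' q := by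
  intro Δ' h1 h2 ε hε
  have hε3 : 0 < ε / 3 := by linarith
  obtain ⟨N₀, hN₀⟩ := hEq Δ' h1 h2
  obtain ⟨N₁, hN₁⟩ := hFP Δ' h1 h2 (ε / 3) hε3
  obtain ⟨N₂, hN₂⟩ := hL Δ' h1 h2 (ε / 3) hε3
  obtain ⟨N₃, hN₃⟩ := hX Δ' h1 h2 (ε / 3) hε3
  refine ⟨max (max N₀ N₁) (max N₂ N₃), fun N hN ↦ ?_⟩
  have h0 : N₀ ≤ N := le_trans (le_trans (le_max_left _ _) (le_max_left _ _)) hN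
  have h1' : N₁ ≤ N := le_trans (le_trans (le_max_right _ _) (le_max_left _ _)) hN
  have h2' : N₂ ≤ N := le_trans (le_trans (le_max_left _ _) (le_max_right _ _)) hN
  have h3' : N₃ ≤ N := le_trans (le_trans (le_max_right _ _) (le_max_right _ _)) hN
  rw [hN₀ N h0]
  have ha := hN₁ N h1'
  have hb := hN₂ N h2'
  have hc := hN₃ N h3'
  linarith

/-- **L9″: the heart from an eventual piece decomposition of the finite dual core.** For a height `Hf` with the
truncation estimate (T), pieces `P S L Xc : ℝ → ℕ → ℝ` with the EVENTUAL identity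
`Σ_{q ∈ goodPrimes Δ′ N} offDiagCore Hf Δ′ q = P + S + L + Xc` (every `Δ′ ∈ (1,2)`, all large `N`), a further split
`P = FP + U`, funded `FP`, `L`, `Xc`, and the clean-scale residual block bound for `S + U` (some `U′ < 4(Δ′−1)/Δ′`,
`c₀′`-first shell), `stub_offDiagBelowSlack_io` holds VERBATIM.
[cite: MontgomeryVaughan2007, Cor. 11.10 (Page); KowalskiMichelVanderKam2000, §6 p. 19 — derivation] -/
theorem offDiagBelowSlack_io_of_pieces (Hf : ℕ → ℕ → ℕ → ℕ → ℕ → ℕ → ℕ × ℕ → ℕ)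
    (hT : ∀ Δ' : ℝ, 1 < Δ' → Δ' < 2 → ∀ ε : ℝ, 0 < ε → ∃ q₀ : ℕ, ∀ q : ℕ, q₀ ≤ q → q.Prime →
      |offDiagNearHead Δ' q - offDiagCore Hf Δ' q| ≤ ε * mainScaleReal Δ' q)
    (P S L Xc FP U : ℝ → ℕ → ℝ)
    (hsplit : ∀ Δ' : ℝ, 1 < Δ' → Δ' < 2 → ∃ N₀ : ℕ, ∀ N : ℕ, N₀ ≤ N →
      ∑ q ∈ goodPrimes Δ' N, offDiagCore Hf Δ' q = P Δ' N + S Δ' N + L Δ' N + Xc Δ' N)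
    (hPsplit : ∀ Δ' : ℝ, 1 < Δ' → Δ' < 2 → ∀ N : ℕ, P Δ' N = FP Δ' N + U Δ' N)
    (hFP : ∀ Δ' : ℝ, 1 < Δ' → Δ' < 2 → ∀ ε : ℝ, 0 < ε → ∃ N₀ : ℕ, ∀ N : ℕ, N₀ ≤ N →
      FP Δ' N ≤ ε * ∑ q ∈ goodPrimes Δ' N, mainScaleReal Δ' q)
    (hL : ∀ Δ' : ℝ, 1 < Δ' → Δ' < 2 → ∀ ε : ℝ, 0 < ε → ∃ N₀ : ℕ, ∀ N : ℕ, N₀ ≤ N →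
      L Δ' N ≤ ε * ∑ q ∈ goodPrimes Δ' N, mainScaleReal Δ' q)
    (hX : ∀ Δ' : ℝ, 1 < Δ' → Δ' < 2 → ∀ ε : ℝ, 0 < ε → ∃ N₀ : ℕ, ∀ N : ℕ, N₀ ≤ N →
      Xc Δ' N ≤ ε * ∑ q ∈ goodPrimes Δ' N, mainScaleReal Δ' q)
    (hR : ∀ c₀' : ℝ, 0 < c₀' → ∃ b : ℝ, 1 < b ∧ ∀ Δ' : ℝ, 1 < Δ' → Δ' < b →
      ∃ U' : ℝ, U' < 4 * (Δ' - 1) / Δ' ∧ ∃ a₀ : ℝ, 0 < a₀ ∧ ∃ η' : ℝ, 0 < η' ∧ η' < c₀' / a₀ ∧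
        ∃ N₀ : ℕ, ∀ N : ℕ, N₀ ≤ N → CleanScale a₀ η' N →
          S Δ' N + U Δ' N ≤ U' * ∑ q ∈ goodPrimes Δ' N, mainScaleReal Δ' q) :
    ∃ b : ℝ, 1 < b ∧ ∀ Δ' : ℝ, 1 < Δ' → Δ' < b → ∃ U : ℝ, U < 4 * (Δ' - 1) / Δ' ∧
      ∀ q₀ : ℕ, ∃ q : ℕ, ∃ _ : NeZero q, q₀ ≤ q ∧ q.Prime ∧
        (∀ n : ℕ, (n : ℝ) ≠ qhat q ^ Δ') ∧
          -(∑ l ∈ Icc 1 ⌊qhat q ^ Δ'⌋₊, ∑ m ∈ Icc 1 ⌊qhat q ^ Δ'⌋₊,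
              ((mollifierCoeff (X ^ 2) (qhat q ^ Δ') l * mollifierCoeff (X ^ 2) (qhat q ^ Δ') m : ℝ) : ℂ) *
                offDiag q l m).re ≤ U * mainScaleReal Δ' q := by
  -- the funded part is `total − residual`, so that the identity holds for every `N`
  refine offDiagBelowSlack_io_of_residual Hf
    (fun Δ' N ↦ (∑ q ∈ goodPrimes Δ' N, offDiagCore Hf Δ' q) - (S Δ' N + U Δ' N))
    (fun Δ' N ↦ S Δ' N + U Δ' N) hT (fun Δ' _ _ N ↦ by ring) ?_ hR
  refine funded_of_eventually_eq_add_add _ FP L Xc (fun Δ' h1 h2 ↦ ?_) hFP hL hX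
  obtain ⟨N₀, hN₀⟩ := hsplit Δ' h1 h2
  refine ⟨N₀, fun N hN ↦ ?_⟩
  rw [hN₀ N hN, hPsplit Δ' h1 h2 N]
  ring

/-- **L9″ at the height `coreHeight ε₀`**: the same with (T) discharged by K1
(`abs_offDiagNearHead_sub_offDiagCore_le_eventually`), for any `ε₀ ∈ (0, 1]`.
[cite: MontgomeryVaughan2007, Cor. 11.10 (Page); KowalskiMichelVanderKam2000, §6 p. 19 — derivation] -/
theorem offDiagBelowSlack_io_of_pieces_coreHeight {ε₀ : ℝ} (hε₀ : 0 < ε₀) (hε₁ : ε₀ ≤ 1)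
    (P S L Xc FP U : ℝ → ℕ → ℝ)
    (hsplit : ∀ Δ' : ℝ, 1 < Δ' → Δ' < 2 → ∃ N₀ : ℕ, ∀ N : ℕ, N₀ ≤ N →
      ∑ q ∈ goodPrimes Δ' N, offDiagCore (coreHeight ε₀) Δ' q = P Δ' N + S Δ' N + L Δ' N + Xc Δ' N)
    (hPsplit : ∀ Δ' : ℝ, 1 < Δ' → Δ' < 2 → ∀ N : ℕ, P Δ' N = FP Δ' N + U Δ' N)
    (hFP : ∀ Δ' : ℝ, 1 < Δ' → Δ' < 2 → ∀ ε : ℝ, 0 < ε → ∃ N₀ : ℕ, ∀ N : ℕ, N₀ ≤ N →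
      FP Δ' N ≤ ε * ∑ q ∈ goodPrimes Δ' N, mainScaleReal Δ' q)
    (hL : ∀ Δ' : ℝ, 1 < Δ' → Δ' < 2 → ∀ ε : ℝ, 0 < ε → ∃ N₀ : ℕ, ∀ N : ℕ, N₀ ≤ N →
      L Δ' N ≤ ε * ∑ q ∈ goodPrimes Δ' N, mainScaleReal Δ' q)
    (hX : ∀ Δ' : ℝ, 1 < Δ' → Δ' < 2 → ∀ ε : ℝ, 0 < ε → ∃ N₀ : ℕ, ∀ N : ℕ, N₀ ≤ N →
      Xc Δ' N ≤ ε * ∑ q ∈ goodPrimes Δ' N, mainScaleReal Δ' q)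
    (hR : ∀ c₀' : ℝ, 0 < c₀' → ∃ b : ℝ, 1 < b ∧ ∀ Δ' : ℝ, 1 < Δ' → Δ' < b →
      ∃ U' : ℝ, U' < 4 * (Δ' - 1) / Δ' ∧ ∃ a₀ : ℝ, 0 < a₀ ∧ ∃ η' : ℝ, 0 < η' ∧ η' < c₀' / a₀ ∧
        ∃ N₀ : ℕ, ∀ N : ℕ, N₀ ≤ N → CleanScale a₀ η' N →
          S Δ' N + U Δ' N ≤ U' * ∑ q ∈ goodPrimes Δ' N, mainScaleReal Δ' q) :
    ∃ b : ℝ, 1 < b ∧ ∀ Δ' : ℝ, 1 < Δ' → Δ' < b → ∃ U : ℝ, U < 4 * (Δ' - 1) / Δ' ∧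
      ∀ q₀ : ℕ, ∃ q : ℕ, ∃ _ : NeZero q, q₀ ≤ q ∧ q.Prime ∧
        (∀ n : ℕ, (n : ℝ) ≠ qhat q ^ Δ') ∧
          -(∑ l ∈ Icc 1 ⌊qhat q ^ Δ'⌋₊, ∑ m ∈ Icc 1 ⌊qhat q ^ Δ'⌋₊,
              ((mollifierCoeff (X ^ 2) (qhat q ^ Δ') l * mollifierCoeff (X ^ 2) (qhat q ^ Δ') m : ℝ) : ℂ) *
                offDiag q l m).re ≤ U * mainScaleReal Δ' q :=
  offDiagBelowSlack_io_of_pieces (coreHeight ε₀) (abs_offDiagNearHead_sub_offDiagCore_le_eventually hε₀ hε₁)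
    P S L Xc FP U hsplit hPsplit hFP hL hX hR

end Summit.Parity.GeneralizedHardyLittlewood.Theorems.BeyondDiagonalBeatsQuarter.OffDiag

end
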